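import Literature.Geometry.Riemannian.GromovW1Distance
import Mathlib.Topology.MetricSpace.Gluing
import Mathlib.Topology.MetricSpace.Polish
import HarnessLib

/-!
# The triangle inequality for the Gromov–`W₁`–Wasserstein distance (Bamler 2023, §2.4)

R. Bamler, *Compactness theory of the space of super Ricci flows*, Invent. Math. 233 (2023), §2.4,
Proposition: *"`d_{GW_p}` satisfies all properties of a pseudometric that is allowed to attain the
value `∞`"*, proved (for `p = 1`) as printed: given embeddings of `X₁, X₂` into `Z₁₂` and of
`X₂, X₃` into `Z₂₃`, the two ambient spaces are glued along `X₂` (Lemma (combining isometric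
embeddings) — here Mathlib's `Metric.GlueSpace`), and in the glued space
`d_{W₁}((φ₁)_* μ₁, (φ₃)_* μ₃) ≤ d_{W₁}((φ₁)_* μ₁, (φ₂)_* μ₂) + d_{W₁}((φ₂)_* μ₂, (φ₃)_* μ₃)`, while
the isometric embeddings `Z₁₂, Z₂₃ → Z` do not increase `d_{W₁}`. The triangle inequality for
`d_{W₁}` between push-forwards of probability measures on complete separable metric spaces under
isometric embeddings into an ARBITRARY common metric space is obtained by pulling the couplings
back to the Polish pieces (an isometric embedding of a complete space is a closed, hence
measurable, embedding), gluing there (`IsCoupling.exists_glue`, disintegration) and pushing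
forward:

* `IsCoupling.comap_prodMap` — pull-back of a coupling of `(Φ₁)_* μ₁, (Φ₂)_* μ₂` along the
  measurable embedding `Φ₁ × Φ₂`;
* `wassersteinW1_map_triangle` — the `d^G_{W₁}` triangle inequality for push-forwards under
  isometric embeddings `Xᵢ → G` of complete separable `Xᵢ`;
* `gromovW1_triangle` — **`d_{GW₁}(1, 3) ≤ d_{GW₁}(1, 2) + d_{GW₁}(2, 3)`** for probability
  measures on complete separable metric spaces.

Everything is proved; no definitions, no named facts.

## References

* R. H. Bamler, *Compactness theory of the space of super Ricci flows*, Invent. Math. 233 (2023),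
  §2.4, Proposition (`d_{GW_p}` is a pseudometric) and Lemma (combining isometric embeddings).
  [Bamler2023]
* C. Villani, *Topics in Optimal Transportation*, GSM 58 (AMS 2003), Lemma 7.6. [Villani2003]
-/

noncomputable section

open Set MeasureTheory Filter Topology
open scoped ENNReal NNReal

namespace Literature.Geometry.Riemannian

universe u

/-! ### Pull-back of couplings along measurable embeddings -/

/-- **Pull-back of a coupling along a product of measurable embeddings**: if `q` couples
`(Φ₁)_* μ₁` and `(Φ₂)_* μ₂` for measurable embeddings `Φ₁ : X₁ → G`, `Φ₂ : X₂ → G` and probability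
measures `μᵢ`, then `q` is carried by `range Φ₁ × range Φ₂`, its pull-back `(Φ₁ × Φ₂)^* q` couples
`μ₁, μ₂`, and pushes forward to `q` again. [folklore] -/
theorem IsCoupling.comap_prodMap {X₁ X₂ G : Type*} [MeasurableSpace X₁] [MeasurableSpace X₂]
    [MeasurableSpace G] {Φ₁ : X₁ → G} {Φ₂ : X₂ → G} (h₁ : MeasurableEmbedding Φ₁)
    (h₂ : MeasurableEmbedding Φ₂) {μ₁ : Measure X₁} {μ₂ : Measure X₂} [IsProbabilityMeasure μ₁]
    [IsProbabilityMeasure μ₂] {q : Measure (G × G)} (hq : IsCoupling (μ₁.map Φ₁) (μ₂.map Φ₂) q) :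
    IsCoupling μ₁ μ₂ (q.comap (Prod.map Φ₁ Φ₂)) ∧
      (q.comap (Prod.map Φ₁ Φ₂)).map (Prod.map Φ₁ Φ₂) = q := by
  obtain ⟨hqP, hq1, hq2⟩ := hq
  haveI := hqP
  have hE : MeasurableEmbedding (Prod.map Φ₁ Φ₂) := h₁.prodMap h₂
  -- `q` is carried by `range Φ₁ × range Φ₂`
  have hnull₁ : q (Prod.fst ⁻¹' (range Φ₁)ᶜ) = 0 := by
    have h : q.fst (range Φ₁)ᶜ = 0 := by
      rw [hq1, h₁.map_apply, preimage_compl, preimage_range, compl_univ, measure_empty]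
    rwa [Measure.fst_apply h₁.measurableSet_range.compl] at h
  have hnull₂ : q (Prod.snd ⁻¹' (range Φ₂)ᶜ) = 0 := by
    have h : q.snd (range Φ₂)ᶜ = 0 := by
      rw [hq2, h₂.map_apply, preimage_compl, preimage_range, compl_univ, measure_empty]
    rwa [Measure.snd_apply h₂.measurableSet_range.compl] at h
  have hcompl : q (range (Prod.map Φ₁ Φ₂))ᶜ = 0 := by
    rw [range_prodMap]
    refine measure_mono_null (fun p hp ↦ ?_) (measure_union_null hnull₁ hnull₂)
    simp only [mem_compl_iff, mem_prod, not_and_or] at hp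
    rcases hp with h | h
    · exact Or.inl h
    · exact Or.inr h
  have hcarried : ∀ᵐ p ∂q, p ∈ range (Prod.map Φ₁ Φ₂) := by
    rw [ae_iff]
    exact hcompl
  have hmap : (q.comap (Prod.map Φ₁ Φ₂)).map (Prod.map Φ₁ Φ₂) = q := by
    rw [hE.map_comap, Measure.restrict_eq_self_of_ae_mem hcarried]
  -- sets of the form `S × range Φ₂` and `range Φ₁ × S` have full second, resp. first, factor
  have hkill₂ : ∀ S : Set G, q (S ×ˢ range Φ₂) = q (S ×ˢ univ) := fun S ↦ by
    refine measure_congr (ae_eq_set.2 ⟨?_, ?_⟩)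
    · exact measure_mono_null (fun p hp ↦ (hp.2 ⟨hp.1.1, mem_univ _⟩).elim) measure_empty
    · exact measure_mono_null (fun p hp ↦ hp.2 ∘ fun h ↦ ⟨hp.1.1, h⟩) hnull₂
  have hkill₁ : ∀ S : Set G, q (range Φ₁ ×ˢ S) = q (univ ×ˢ S) := fun S ↦ by
    refine measure_congr (ae_eq_set.2 ⟨?_, ?_⟩)
    · exact measure_mono_null (fun p hp ↦ (hp.2 ⟨mem_univ _, hp.1.2⟩).elim) measure_empty
    · exact measure_mono_null (fun p hp ↦ hp.2 ∘ fun h ↦ ⟨h, hp.1.2⟩) hnull₁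
  refine ⟨⟨⟨?_⟩, ?_, ?_⟩, hmap⟩
  · -- total mass
    rw [hE.comap_apply, image_univ, ← prob_compl_eq_zero_iff hE.measurableSet_range]
    exact hcompl
  · -- first marginal
    ext A hA
    rw [Measure.fst_apply hA, hE.comap_apply, ← prod_univ, prodMap_image_prod, image_univ,
      hkill₂, prod_univ, ← Measure.fst_apply (h₁.measurableSet_image' hA), hq1, h₁.map_apply,
      preimage_image_eq _ h₁.injective]
  · -- second marginal
    ext A hA
    rw [Measure.snd_apply hA, hE.comap_apply, ← univ_prod, prodMap_image_prod, image_univ,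
      hkill₁, univ_prod, ← Measure.snd_apply (h₂.measurableSet_image' hA), hq2, h₂.map_apply,
      preimage_image_eq _ h₂.injective]

/-! ### The triangle inequality for `d_{W₁}` between push-forwards under isometric embeddings -/

section MapTriangle

variable {X₁ X₂ X₃ : Type*} [MetricSpace X₁] [MeasurableSpace X₁] [BorelSpace X₁]
  [SecondCountableTopology X₁] [CompleteSpace X₁] [MetricSpace X₂] [MeasurableSpace X₂]
  [BorelSpace X₂] [SecondCountableTopology X₂] [CompleteSpace X₂] [MetricSpace X₃]
  [MeasurableSpace X₃] [BorelSpace X₃] [SecondCountableTopology X₃] [CompleteSpace X₃]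
  {G : Type*} [MetricSpace G] [MeasurableSpace G] [BorelSpace G]

/-- **Triangle inequality for `d_{W₁}` between push-forwards under isometric embeddings**
(the step in the glued space of Bamler 2023, §2.4, proof of the Proposition): for isometric
embeddings `Φᵢ : Xᵢ → G` of complete separable metric spaces into an arbitrary metric space `G`
and probability measures `μᵢ`,
`d^G_{W₁}((Φ₁)_* μ₁, (Φ₃)_* μ₃) ≤ d^G_{W₁}((Φ₁)_* μ₁, (Φ₂)_* μ₂) + d^G_{W₁}((Φ₂)_* μ₂, (Φ₃)_* μ₃)`:
couplings on `G × G` are pulled back to `X₁ × X₂` and `X₂ × X₃` (`IsCoupling.comap_prodMap`),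
glued along `X₂` (`IsCoupling.exists_glue`) and pushed forward by `Φ₁ × Φ₃`, with
`d(Φ₁ x₁, Φ₃ x₃) ≤ d(Φ₁ x₁, Φ₂ x₂) + d(Φ₂ x₂, Φ₃ x₃)` integrated.
[cite: Bamler2023, §2.4, Proposition (d_{GW_p} is a pseudometric)] [cite: Villani2003, Lemma 7.6] -/
theorem wassersteinW1_map_triangle {Φ₁ : X₁ → G} {Φ₂ : X₂ → G} {Φ₃ : X₃ → G} (hΦ₁ : Isometry Φ₁)
    (hΦ₂ : Isometry Φ₂) (hΦ₃ : Isometry Φ₃) (μ₁ : Measure X₁) (μ₂ : Measure X₂) (μ₃ : Measure X₃)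
    [IsProbabilityMeasure μ₁] [IsProbabilityMeasure μ₂] [IsProbabilityMeasure μ₃] :
    wassersteinW1 (μ₁.map Φ₁) (μ₃.map Φ₃) ≤
      wassersteinW1 (μ₁.map Φ₁) (μ₂.map Φ₂) + wassersteinW1 (μ₂.map Φ₂) (μ₃.map Φ₃) := by
  have hme₁ : MeasurableEmbedding Φ₁ := hΦ₁.isClosedEmbedding.measurableEmbedding
  have hme₂ : MeasurableEmbedding Φ₂ := hΦ₂.isClosedEmbedding.measurableEmbedding
  have hme₃ : MeasurableEmbedding Φ₃ := hΦ₃.isClosedEmbedding.measurableEmbedding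
  refine ENNReal.le_iInf_add_iInf fun q₁₂ q₂₃ ↦ ?_
  obtain ⟨q₁₂, h₁₂⟩ := q₁₂
  obtain ⟨q₂₃, h₂₃⟩ := q₂₃
  -- pull back and glue
  obtain ⟨hc₁₂, hmap₁₂⟩ := h₁₂.comap_prodMap hme₁ hme₂
  obtain ⟨hc₂₃, hmap₂₃⟩ := h₂₃.comap_prodMap hme₂ hme₃
  obtain ⟨γ, hγP, hγ₁₂, hγ₂₃⟩ := hc₁₂.exists_glue hc₂₃
  haveI := hγP
  have hP₁₂ : Measurable fun p : X₂ × (X₁ × X₃) ↦ (p.2.1, p.1) :=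
    measurable_snd.fst.prodMk measurable_fst
  have hP₂₃ : Measurable fun p : X₂ × (X₁ × X₃) ↦ (p.1, p.2.2) :=
    measurable_fst.prodMk measurable_snd.snd
  -- the glued coupling on `G × G`
  set F : X₂ × (X₁ × X₃) → G × G := fun p ↦ (Φ₁ p.2.1, Φ₃ p.2.2) with hF_def
  have hF : Measurable F :=
    (hme₁.measurable.comp measurable_snd.fst).prodMk (hme₃.measurable.comp measurable_snd.snd)
  have hc₁₃ : IsCoupling (μ₁.map Φ₁) (μ₃.map Φ₃) (γ.map F) := by
    refine ⟨Measure.isProbabilityMeasure_map hF.aemeasurable, ?_, ?_⟩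
    · rw [Measure.fst, Measure.map_map measurable_fst hF, ← hc₁₂.2.1, ← hγ₁₂, Measure.fst,
        Measure.map_map measurable_fst hP₁₂,
        Measure.map_map hme₁.measurable (measurable_fst.comp hP₁₂)]
      rfl
    · rw [Measure.snd, Measure.map_map measurable_snd hF, ← hc₂₃.2.2, ← hγ₂₃, Measure.snd,
        Measure.map_map measurable_snd hP₂₃,
        Measure.map_map hme₃.measurable (measurable_snd.comp hP₂₃)]
      rfl
  -- its cost
  have hm₁ : Measurable fun p : X₂ × (X₁ × X₃) ↦ edist (Φ₁ p.2.1) (Φ₂ p.1) :=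
    ((hΦ₁.continuous.comp (continuous_snd.fst)).edist (hΦ₂.continuous.comp continuous_fst)).measurable
  have hm₂ : Measurable fun p : X₂ × (X₁ × X₃) ↦ edist (Φ₂ p.1) (Φ₃ p.2.2) :=
    ((hΦ₂.continuous.comp continuous_fst).edist (hΦ₃.continuous.comp continuous_snd.snd)).measurable
  have hm₁₂ : Measurable fun p : X₁ × X₂ ↦ edist (Φ₁ p.1) (Φ₂ p.2) :=
    ((hΦ₁.continuous.comp continuous_fst).edist (hΦ₂.continuous.comp continuous_snd)).measurable
  have hm₂₃ : Measurable fun p : X₂ × X₃ ↦ edist (Φ₂ p.1) (Φ₃ p.2) :=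
    ((hΦ₂.continuous.comp continuous_fst).edist (hΦ₃.continuous.comp continuous_snd)).measurable
  have hpull₁₂ : ∫⁻ p, edist (Φ₁ p.1) (Φ₂ p.2) ∂(q₁₂.comap (Prod.map Φ₁ Φ₂)) =
      ∫⁻ z, edist z.1 z.2 ∂q₁₂ := by
    have h := (hme₁.prodMap hme₂).lintegral_map (μ := q₁₂.comap (Prod.map Φ₁ Φ₂))
      (fun z : G × G ↦ edist z.1 z.2)
    rw [hmap₁₂] at h
    rw [h]
    rfl
  have hpull₂₃ : ∫⁻ p, edist (Φ₂ p.1) (Φ₃ p.2) ∂(q₂₃.comap (Prod.map Φ₂ Φ₃)) =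
      ∫⁻ z, edist z.1 z.2 ∂q₂₃ := by
    have h := (hme₂.prodMap hme₃).lintegral_map (μ := q₂₃.comap (Prod.map Φ₂ Φ₃))
      (fun z : G × G ↦ edist z.1 z.2)
    rw [hmap₂₃] at h
    rw [h]
    rfl
  have hcost : ∫⁻ z, edist z.1 z.2 ∂(γ.map F) ≤
      ∫⁻ z, edist z.1 z.2 ∂q₁₂ + ∫⁻ z, edist z.1 z.2 ∂q₂₃ := by
    calc ∫⁻ z, edist z.1 z.2 ∂(γ.map F)
        ≤ ∫⁻ p, edist (Φ₁ p.2.1) (Φ₃ p.2.2) ∂γ := lintegral_map_le _ _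
      _ ≤ ∫⁻ p, edist (Φ₁ p.2.1) (Φ₂ p.1) + edist (Φ₂ p.1) (Φ₃ p.2.2) ∂γ :=
          lintegral_mono fun p ↦ edist_triangle _ _ _
      _ = ∫⁻ p, edist (Φ₁ p.2.1) (Φ₂ p.1) ∂γ + ∫⁻ p, edist (Φ₂ p.1) (Φ₃ p.2.2) ∂γ :=
          lintegral_add_left hm₁ _
      _ = ∫⁻ p, edist (Φ₁ p.1) (Φ₂ p.2) ∂(q₁₂.comap (Prod.map Φ₁ Φ₂)) +
            ∫⁻ p, edist (Φ₂ p.1) (Φ₃ p.2) ∂(q₂₃.comap (Prod.map Φ₂ Φ₃)) := by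
          rw [← hγ₁₂, ← hγ₂₃, lintegral_map hm₁₂ hP₁₂, lintegral_map hm₂₃ hP₂₃]
      _ = ∫⁻ z, edist z.1 z.2 ∂q₁₂ + ∫⁻ z, edist z.1 z.2 ∂q₂₃ := by rw [hpull₁₂, hpull₂₃]
  exact (wassersteinW1_le_lintegral hc₁₃).trans hcost

end MapTriangle

/-! ### The triangle inequality for `d_{GW₁}` -/

/-- **`d_{GW₁}` satisfies the triangle inequality** (Bamler 2023, §2.4, Proposition: `d_{GW_p}`
is a pseudometric allowed to attain `∞`; here `p = 1`), for probability measures on complete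
separable metric spaces (metric measure spaces): the printed proof — glue the ambient spaces of
two pairs of embeddings along `X₂` (Lemma (combining isometric embeddings), `Metric.GlueSpace`),
use the triangle inequality of `d_{W₁}` in the glued space (`wassersteinW1_map_triangle`) and the
monotonicity of `d_{W₁}` under the isometric embeddings of the two ambient spaces into the glued
space (`wassersteinW1_map_le_of_edist_le`), then take infima.
[cite: Bamler2023, §2.4, Proposition (d_{GW_p} is a pseudometric)] -/
theorem gromovW1_triangle {X₁ X₂ X₃ : Type u} [MetricSpace X₁] [MeasurableSpace X₁] [BorelSpace X₁]
    [SecondCountableTopology X₁] [CompleteSpace X₁] [MetricSpace X₂] [MeasurableSpace X₂]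
    [BorelSpace X₂] [SecondCountableTopology X₂] [CompleteSpace X₂] [MetricSpace X₃]
    [MeasurableSpace X₃] [BorelSpace X₃] [SecondCountableTopology X₃] [CompleteSpace X₃]
    (μ₁ : Measure X₁) (μ₂ : Measure X₂) (μ₃ : Measure X₃) [IsProbabilityMeasure μ₁]
    [IsProbabilityMeasure μ₂] [IsProbabilityMeasure μ₃] :
    gromovW1 μ₁ μ₃ ≤ gromovW1 μ₁ μ₂ + gromovW1 μ₂ μ₃ := by
  -- `X₂` is nonempty (it carries a probability measure)
  haveI : Nonempty X₂ := by
    by_contra hX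
    rw [not_nonempty_iff] at hX
    have h1 : μ₂ univ = 1 := measure_univ
    rw [univ_eq_empty_iff.2 inferInstance, measure_empty] at h1
    exact zero_ne_one h1
  -- the estimate for two given pairs of embeddings
  have key : ∀ (Z : Type u) [MetricSpace Z] [MeasurableSpace Z] [BorelSpace Z] (φ₁ : X₁ → Z)
      (φ₂ : X₂ → Z), Isometry φ₁ → ∀ hφ₂ : Isometry φ₂,
      ∀ (Z' : Type u) [MetricSpace Z'] [MeasurableSpace Z'] [BorelSpace Z'] (ψ₂ : X₂ → Z')
      (ψ₃ : X₃ → Z'), ∀ hψ₂ : Isometry ψ₂, Isometry ψ₃ →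
      gromovW1 μ₁ μ₃ ≤ wassersteinW1 (μ₁.map φ₁) (μ₂.map φ₂) +
        wassersteinW1 (μ₂.map ψ₂) (μ₃.map ψ₃) := by
    intro Z _ _ _ φ₁ φ₂ hφ₁ hφ₂ Z' _ _ _ ψ₂ ψ₃ hψ₂ hψ₃
    -- glue `Z` and `Z'` along `X₂`
    letI : MeasurableSpace (Metric.GlueSpace hφ₂ hψ₂) := borel _
    haveI : BorelSpace (Metric.GlueSpace hφ₂ hψ₂) := ⟨rfl⟩
    have hL : Isometry (Metric.toGlueL hφ₂ hψ₂) := Metric.toGlueL_isometry hφ₂ hψ₂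
    have hR : Isometry (Metric.toGlueR hφ₂ hψ₂) := Metric.toGlueR_isometry hφ₂ hψ₂
    have hcomm : Metric.toGlueL hφ₂ hψ₂ ∘ φ₂ = Metric.toGlueR hφ₂ hψ₂ ∘ ψ₂ :=
      Metric.toGlue_commute hφ₂ hψ₂
    have hLm : Measurable (Metric.toGlueL hφ₂ hψ₂) := hL.continuous.measurable
    have hRm : Measurable (Metric.toGlueR hφ₂ hψ₂) := hR.continuous.measurable
    calc gromovW1 μ₁ μ₃
        ≤ wassersteinW1 (μ₁.map (Metric.toGlueL hφ₂ hψ₂ ∘ φ₁))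
            (μ₃.map (Metric.toGlueR hφ₂ hψ₂ ∘ ψ₃)) :=
          gromovW1_le_wassersteinW1_map μ₁ μ₃ (hL.comp hφ₁) (hR.comp hψ₃)
      _ ≤ wassersteinW1 (μ₁.map (Metric.toGlueL hφ₂ hψ₂ ∘ φ₁))
            (μ₂.map (Metric.toGlueL hφ₂ hψ₂ ∘ φ₂)) +
          wassersteinW1 (μ₂.map (Metric.toGlueL hφ₂ hψ₂ ∘ φ₂))
            (μ₃.map (Metric.toGlueR hφ₂ hψ₂ ∘ ψ₃)) :=
          wassersteinW1_map_triangle (hL.comp hφ₁) (hL.comp hφ₂) (hR.comp hψ₃) μ₁ μ₂ μ₃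
      _ ≤ wassersteinW1 (μ₁.map φ₁) (μ₂.map φ₂) + wassersteinW1 (μ₂.map ψ₂) (μ₃.map ψ₃) := by
          refine add_le_add ?_ ?_
          · rw [← Measure.map_map hLm hφ₁.continuous.measurable,
              ← Measure.map_map hLm hφ₂.continuous.measurable]
            exact wassersteinW1_map_le_of_edist_le hLm (fun a b ↦ (hL.edist_eq a b).le) _ _
          · rw [hcomm, ← Measure.map_map hRm hψ₂.continuous.measurable,
              ← Measure.map_map hRm hψ₃.continuous.measurable]
            exact wassersteinW1_map_le_of_edist_le hRm (fun a b ↦ (hR.edist_eq a b).le) _ _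
  -- take infima
  refine ENNReal.le_iInf_add_iInf fun Z Z' ↦ ENNReal.le_iInf_add_iInf fun _ _ ↦
    ENNReal.le_iInf_add_iInf fun φ₁ ψ₂ ↦ ENNReal.le_iInf_add_iInf fun φ₂ ψ₃ ↦
    ENNReal.le_iInf_add_iInf fun hφ₁ hψ₂ ↦ ENNReal.le_iInf_add_iInf fun hφ₂ hψ₃ ↦ ?_
  letI : MeasurableSpace Z := borel Z
  haveI : BorelSpace Z := ⟨rfl⟩
  letI : MeasurableSpace Z' := borel Z'
  haveI : BorelSpace Z' := ⟨rfl⟩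
  exact key Z φ₁ φ₂ hφ₁ hφ₂ Z' ψ₂ ψ₃ hψ₂ hψ₃

end Literature.Geometry.Riemannian

end
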